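import Summits.AtomisticToContinuum.Crystallization.Theses.HcpDefectCounting
import Literature.MathematicalPhysics.StatisticalMechanics.LocalMatchingCompactness

/-!
# Route HullExactificationCascade, crux `HcpLandscapeGap` (stmt-AtomisticToContinuum-12087), line `birth` —
# the master priced inequality from the sibling cruxes of route HcpDefectCounting

`master_of`: the registered stub `stub_master` of the skeleton `Cruxes/HcpLandscapeGap/Lines/birth.lean`
CONDITIONALLY on (i) the boundary-layer estimate for separated sets (registered stub `stub_boundaryLayer`,
taken as a hypothesis here), (ii) the bulk floor `HcpDefectCounting.HcpBulkFloor` (stmt-14477) and (iii) the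
defect-counting coercivity `HcpDefectCounting.HcpDefectCoercivity` (stmt-14476).  Statement: at an enclosed
global minimiser `(a,h)` of `e(hcp a h)` and for any priced predicate `Bad S y` that fails at `Good(4,θ)` sites
of `δ`-separated sets, `2e·#(S∩B̄_L(c)) + κ·#{Bad} − C(L+1)² ≤ Σ_{y ∈ S∩B̄_L(c)} Σ'_{z ∈ S, z ≠ y} V_LJ`.
Proof: floor at `(a,h)` by global minimality; `κ₀` from 14476 at `(a,h)` (which lies in its box); enumerate
the finite window `S ∩ B̄_L(c)` (`Set.Finite.fin_embedding`); an interior (`depth ≥ 5`) site that is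
`Good(4,θ)` in the finite cluster is `Good(4,θ)` in `S`, hence not `Bad`; so `{Bad} ⊆ x''{¬Good} ∪ layer`,
and the layer count and the cross interaction are `O((L+1)²)` by (i); `κ = 2κ₀`.  [folklore bookkeeping]
-/

namespace Summit.AtomisticToContinuum.Crystallization.Theorems.HcpLandscapeGapBirth

/-- **Master priced inequality, conditional form** (see the module docstring): boundary-layer estimate →
`HcpBulkFloor` → `HcpDefectCoercivity` → registered `stub_master`. [folklore] -/
theorem master_of : (∀ δ : ℝ, 0 < δ → ∀ ρ : ℝ, 0 ≤ ρ → ∃ C : ℝ, ∀ S : Set (EuclideanSpace ℝ (Fin 3)), (∀ y ∈ S, ∀ z ∈ S, y ≠ z → δ ≤ dist y z) → ∀ (c : EuclideanSpace ℝ (Fin 3)) (L : ℝ), 0 ≤ L → (({y : EuclideanSpace ℝ (Fin 3) | y ∈ S ∧ dist y c ≤ L ∧ L - ρ < dist y c} : Set (EuclideanSpace ℝ (Fin 3))).ncard : ℝ) ≤ C * (L + 1) ^ 2 ∧ ∀ (n : ℕ) (x : Fin n → EuclideanSpace ℝ (Fin 3)), Function.Injective x → Set.range x = {y : EuclideanSpace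 ℝ (Fin 3) | y ∈ S ∧ dist y c ≤ L} → 2 * Literature.MathematicalPhysics.StatisticalMechanics.interactionEnergy Literature.MathematicalPhysics.StatisticalMechanics.lennardJones x - C * (L + 1) ^ 2 ≤ (∑' y : ↥{y : EuclideanSpace ℝ (Fin 3) | y ∈ S ∧ dist y c ≤ L}, (∑' z : ↥{z : EuclideanSpace ℝ (Fin 3) | z ∈ S ∧ z ≠ (y : EuclideanSpace ℝ (Fin 3))}, Literature.MathematicalPhysics.StatisticalMechanics.lennardJones (dist (y : EuclideanSpace ℝ (Fin 3)) (z : EuclideanSpace ℝ (Fin 3)))))) → Summit.AtomisticToContinuum.Crystallization.Theses.HcpDefectCounting.HcpBulkFloor → Summit.AtomisticToContinuum.Crystallization.Theses.HcpDefectCounting.HcpDefectCoercivity → ∀ a h : ℝ, ∀ ha : a ≠ 0, ∀ hh : h ≠ 0, (|a - 97129 / 100000| ≤ 1 / 10000 ∧ |h - 79294 / 100000| ≤ 1 / 10000) → (∀ a' h' : ℝ, ∀ ha' : a' ≠ 0, ∀ hh' : h' ≠ 0, 0 < a' → 0 < h' → (Literature.MathematicalPhysics.StatisticalMechanics.hcpPeriodicConfiguration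 ha hh).energyPerParticle Literature.MathematicalPhysics.StatisticalMechanics.lennardJones ≤ (Literature.MathematicalPhysics.StatisticalMechanics.hcpPeriodicConfiguration ha' hh').energyPerParticle Literature.MathematicalPhysics.StatisticalMechanics.lennardJones) → ∀ δ : ℝ, 0 < δ → ∀ θ : ℝ, 0 < θ → ∀ Bad : Set (EuclideanSpace ℝ (Fin 3)) → EuclideanSpace ℝ (Fin 3) → Prop, (∀ S : Set (EuclideanSpace ℝ (Fin 3)), (∀ y ∈ S, ∀ z ∈ S, y ≠ z → δ ≤ dist y z) → ∀ y ∈ S, (∃ A : EuclideanSpace ℝ (Fin 3) →ₗᵢ[ℝ] EuclideanSpace ℝ (Fin 3), (∀ p ∈ (Literature.MathematicalPhysics.StatisticalMechanics.hcpPeriodicConfiguration ha hh).points, ‖p‖ ≤ 4 → ∃ z ∈ S, dist z (y + A p) ≤ θ) ∧ (∀ z ∈ S, dist z y ≤ 4 → ∃ p ∈ (Literature.MathematicalPhysics.StatisticalMechanics.hcpPeriodicConfiguration ha hh).points, dist z (y + A p) ≤ θ)) → ¬ Bad S y) → ∃ κ : ℝ, 0 < κ ∧ ∃ C : ℝ,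 ∀ S : Set (EuclideanSpace ℝ (Fin 3)), (∀ y ∈ S, ∀ z ∈ S, y ≠ z → δ ≤ dist y z) → ∀ (c : EuclideanSpace ℝ (Fin 3)) (L : ℝ), 0 ≤ L → 2 * ((Literature.MathematicalPhysics.StatisticalMechanics.hcpPeriodicConfiguration ha hh).energyPerParticle Literature.MathematicalPhysics.StatisticalMechanics.lennardJones) * (({y : EuclideanSpace ℝ (Fin 3) | y ∈ S ∧ dist y c ≤ L} : Set (EuclideanSpace ℝ (Fin 3))).ncard : ℝ) + κ * (({y : EuclideanSpace ℝ (Fin 3) | y ∈ S ∧ dist y c ≤ L ∧ Bad S y} : Set (EuclideanSpace ℝ (Fin 3))).ncard : ℝ) - C * (L + 1) ^ 2 ≤ (∑' y : ↥{y : EuclideanSpace ℝ (Fin 3) | y ∈ S ∧ dist y c ≤ L}, (∑' z : ↥{z : EuclideanSpace ℝ (Fin 3) | z ∈ S ∧ z ≠ (y : EuclideanSpace ℝ (Fin 3))}, Literature.MathematicalPhysics.StatisticalMechanics.lennardJones (dist (y : EuclideanSpace ℝ (Fin 3)) (z : EuclideanSpace ℝ (Fin 3))))) := by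
  intro hL hF hK
  classical
  intro a h ha hh henc hglob δ hδ θ hθ Bad hBad
  -- positivity and the box of the sibling crux at the enclosed parameters
  obtain ⟨hea, heh⟩ := henc
  obtain ⟨ha1, ha2⟩ := abs_le.1 hea
  obtain ⟨hh1, hh2⟩ := abs_le.1 heh
  have hb1 : (47 : ℝ) / 50 ≤ a := by linarith
  have hb2 : a ≤ 1 := by linarith
  have hb3 : 39 / 50 * a ≤ h := by linarith
  have hb4 : h ≤ 17 / 20 * a := by linarith
  -- the floor at (a, h): from the floor at the sibling crux's witness and global minimality
  obtain ⟨a₁, h₁, ha₁, hh₁, hb₁, -, hb₃, -, hfloor₁⟩ := hF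
  have ha₁pos : 0 < a₁ := by linarith
  have hh₁pos : 0 < h₁ := by linarith
  have hfloor : ∀ (N : ℕ) (x : Fin N → EuclideanSpace ℝ (Fin 3)), Function.Injective x →
      (N : ℝ) * (Literature.MathematicalPhysics.StatisticalMechanics.hcpPeriodicConfiguration ha hh).energyPerParticle
          Literature.MathematicalPhysics.StatisticalMechanics.lennardJones ≤
        Literature.MathematicalPhysics.StatisticalMechanics.interactionEnergy
          Literature.MathematicalPhysics.StatisticalMechanics.lennardJones x := by
    intro N x hx
    have h1 := hglob a₁ h₁ ha₁ hh₁ ha₁pos hh₁pos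
    have h2 := hfloor₁ N x hx
    have hN : (0 : ℝ) ≤ N := Nat.cast_nonneg N
    nlinarith
  -- the defect-counting coercivity at (a, h)
  obtain ⟨κ₀, hκ₀, hcoer⟩ := hK a h ha hh hb1 hb2 hb3 hb4 hfloor δ θ hδ hθ
  -- the boundary layer at depth 5
  obtain ⟨C₁, hC₁⟩ := hL δ hδ 5 (by norm_num)
  refine ⟨2 * κ₀, by positivity, C₁ + 2 * κ₀ * C₁, ?_⟩
  intro S hsep c L hL0
  obtain ⟨hlayer, hcross⟩ := hC₁ S hsep c L hL0
  -- the finite window and its enumeration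
  set W : Set (EuclideanSpace ℝ (Fin 3)) := {y | y ∈ S ∧ dist y c ≤ L} with hW
  have hWfin : W.Finite :=
    Literature.MathematicalPhysics.StatisticalMechanics.finite_of_forall_le_dist_of_subset_closedBall hδ
      (fun p hp q hq hpq => hsep p hp.1 q hq.1 hpq) (c := c) (R := L)
      (fun p hp => Metric.mem_closedBall.2 hp.2)
  obtain ⟨n, f, hf⟩ := hWfin.fin_embedding
  have hxW : ∀ i, f i ∈ W := fun i => hf ▸ Set.mem_range_self i
  have hxsep : ∀ i j : Fin n, i ≠ j → δ ≤ dist (f i) (f j) := fun i j hij =>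
    hsep _ (hxW i).1 _ (hxW j).1 (fun h0 => hij (f.injective h0))
  have hncard : (W.ncard : ℝ) = n := by
    rw [← hf, Set.ncard_range_of_injective f.injective, Nat.card_eq_fintype_card, Fintype.card_fin]
  -- 14476 on the window
  have hK1 := hcoer n f hxsep
  have hK2 : (n : ℝ) * (Literature.MathematicalPhysics.StatisticalMechanics.hcpPeriodicConfiguration ha hh).energyPerParticle
        Literature.MathematicalPhysics.StatisticalMechanics.lennardJones +
      κ₀ * (Nat.card {i : Fin n // ¬ (∃ A : EuclideanSpace ℝ (Fin 3) →ₗᵢ[ℝ] EuclideanSpace ℝ (Fin 3),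
        (∀ p ∈ (Literature.MathematicalPhysics.StatisticalMechanics.hcpPeriodicConfiguration ha hh).points,
          ‖p‖ ≤ 4 → ∃ j : Fin n, dist (f j) (f i + A p) ≤ θ) ∧
        (∀ j : Fin n, dist (f j) (f i) ≤ 4 →
          ∃ p ∈ (Literature.MathematicalPhysics.StatisticalMechanics.hcpPeriodicConfiguration ha hh).points,
            dist (f j) (f i + A p) ≤ θ))} : ℝ) ≤
      Literature.MathematicalPhysics.StatisticalMechanics.interactionEnergy
        Literature.MathematicalPhysics.StatisticalMechanics.lennardJones f := hK1
  -- the bad sites of the window: not Good in the cluster, or in the boundary layer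
  set NG : Set (Fin n) := {i | ¬ (∃ A : EuclideanSpace ℝ (Fin 3) →ₗᵢ[ℝ] EuclideanSpace ℝ (Fin 3),
        (∀ p ∈ (Literature.MathematicalPhysics.StatisticalMechanics.hcpPeriodicConfiguration ha hh).points,
          ‖p‖ ≤ 4 → ∃ j : Fin n, dist (f j) (f i + A p) ≤ θ) ∧
        (∀ j : Fin n, dist (f j) (f i) ≤ 4 →
          ∃ p ∈ (Literature.MathematicalPhysics.StatisticalMechanics.hcpPeriodicConfiguration ha hh).points,
            dist (f j) (f i + A p) ≤ θ))} with hNG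
  set Lay : Set (EuclideanSpace ℝ (Fin 3)) := {y | y ∈ S ∧ dist y c ≤ L ∧ L - 5 < dist y c} with hLay
  set B : Set (EuclideanSpace ℝ (Fin 3)) := {y | y ∈ S ∧ dist y c ≤ L ∧ Bad S y} with hB
  have hcardNG : (Nat.card {i : Fin n // ¬ (∃ A : EuclideanSpace ℝ (Fin 3) →ₗᵢ[ℝ] EuclideanSpace ℝ (Fin 3),
        (∀ p ∈ (Literature.MathematicalPhysics.StatisticalMechanics.hcpPeriodicConfiguration ha hh).points,
          ‖p‖ ≤ 4 → ∃ j : Fin n, dist (f j) (f i + A p) ≤ θ) ∧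
        (∀ j : Fin n, dist (f j) (f i) ≤ 4 →
          ∃ p ∈ (Literature.MathematicalPhysics.StatisticalMechanics.hcpPeriodicConfiguration ha hh).points,
            dist (f j) (f i + A p) ≤ θ))} : ℝ) = (NG.ncard : ℝ) := by
    rw [← Nat.card_coe_set_eq, hNG, Set.coe_setOf]
  have hsub : B ⊆ (fun i => (f i : EuclideanSpace ℝ (Fin 3))) '' NG ∪ Lay := by
    intro y hy
    obtain ⟨hyS, hyL, hyBad⟩ := hy
    by_cases hdepth : L - 5 < dist y c
    · exact Or.inr ⟨hyS, hyL, hdepth⟩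
    · push Not at hdepth
      have hyW : y ∈ Set.range f := hf ▸ (⟨hyS, hyL⟩ : y ∈ W)
      obtain ⟨i, rfl⟩ := hyW
      refine Or.inl ⟨i, ?_, rfl⟩
      intro hgood
      obtain ⟨A, hA1, hA2⟩ := hgood
      refine hBad S hsep (f i) hyS ⟨A, ?_, ?_⟩ hyBad
      · intro p hp hp4
        obtain ⟨j, hj⟩ := hA1 p hp hp4
        exact ⟨f j, (hxW j).1, hj⟩
      · intro z hz hz4
        have hzW : z ∈ W := by
          refine ⟨hz, ?_⟩
          calc dist z c ≤ dist z (f i) + dist (f i) c := dist_triangle _ _ _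
            _ ≤ 4 + (L - 5) := add_le_add hz4 hdepth
            _ ≤ L := by linarith
        have hzr : z ∈ Set.range f := hf ▸ hzW
        obtain ⟨j, rfl⟩ := hzr
        exact hA2 j hz4
  have hLayfin : Lay.Finite := hWfin.subset fun y hy => ⟨hy.1, hy.2.1⟩
  have hNGfin : NG.Finite := Set.toFinite NG
  have hBle : (B.ncard : ℝ) ≤ (NG.ncard : ℝ) + (Lay.ncard : ℝ) := by
    have h1 : B.ncard ≤ ((fun i => (f i : EuclideanSpace ℝ (Fin 3))) '' NG ∪ Lay).ncard :=
      Set.ncard_le_ncard hsub ((hNGfin.image _).union hLayfin)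
    have h2 := Set.ncard_union_le ((fun i => (f i : EuclideanSpace ℝ (Fin 3))) '' NG) Lay
    have h3 : ((fun i => (f i : EuclideanSpace ℝ (Fin 3))) '' NG).ncard ≤ NG.ncard := Set.ncard_image_le hNGfin
    exact_mod_cast h1.trans (h2.trans (Nat.add_le_add_right h3 _))
  -- assemble
  have hcross' := hcross n f f.injective hf
  have hNG0 : (0 : ℝ) ≤ (NG.ncard : ℝ) := Nat.cast_nonneg _
  rw [hcardNG] at hK2
  rw [hncard]
  have hκC : 2 * κ₀ * (B.ncard : ℝ) ≤ 2 * κ₀ * (NG.ncard : ℝ) + 2 * κ₀ * (C₁ * (L + 1) ^ 2) := by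
    have h1 : (B.ncard : ℝ) ≤ (NG.ncard : ℝ) + C₁ * (L + 1) ^ 2 := by linarith [hBle, hlayer]
    have h2 := mul_le_mul_of_nonneg_left h1 (by positivity : (0 : ℝ) ≤ 2 * κ₀)
    linarith [h2]
  linarith [hκC, hK2, hcross']

end Summit.AtomisticToContinuum.Crystallization.Theorems.HcpLandscapeGapBirth
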